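import Literature.NumberTheory.BeurlingPrimes.LiKernel
import HarnessLib

/-!
# The template of Broucke–Debruyne–Révész, Theorem 3.2: `F = li(x) + Σ_ω li(x^ω) − Σ_ρ li(x^ρ) + M li(x^δ)`

Topic `Literature/NumberTheory/BeurlingPrimes`, grouping namespace `BDRMultiset` (the construction of BDR 2023, §3).
Everything in this file is PROVED.

For finite multisets `𝒮` (poles) and `ℛ` (zeros) of complex numbers, `0 < δ < 1` and `M ∈ ℕ`, BDR (2023, Lemma 3.1
and proof of Theorem 3.2) use the template prime-counting function
`F(x) = li(x) + Σ_{ω∈𝒮} li(x^ω) − Σ_{ρ∈ℛ} li(x^ρ) + M li(x^δ)` and its "Riemann" companion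
`G(x) = Σ_k F(x^{1/k})/k = Li(x) + Σ Li(x^ω) − Σ Li(x^ρ) + M Li(x^δ)`, where `li(x^z) = Σ_{n≥1} zⁿ(log x)ⁿ/(n·n!·ζ(n+1))`
and `Li(x^z) = Σ_{n≥1} zⁿ(log x)ⁿ/(n·n!)` (§2 (2.3)–(2.4)). As the multisets are symmetric, only REAL parts of the
coefficients matter; we therefore DEFINE the template through the real power series in `log x` of the tree
(`logSeries`, `LogPowerSeries.lean`) with the coefficients
`A n = 1 + Re Σ_𝒮 ωⁿ − Re Σ_ℛ ρⁿ + M δⁿ` (`powCoeff`), namely `F = logSeries (n ↦ A n/(n ζ(n+1)))`,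
`G = logSeries (n ↦ A n/n)` at `log x` (`tmplF`, `tmplG`, both `0` on `(−∞, 1]`).

Main results (for `0 ≤ δ ≤ 1`):
* coefficient bounds `|A n| ≤ B Qⁿ` (`abs_powCoeff_le`), derivatives `F′(x) = NF(log x)/(x log x)`,
  `G′(x) = NG(log x)/(x log x)` on `(1, ∞)` with `NF = logSeries (invZetaCoeff · A)`, `NG = logSeries ([n≥1] A)`
  (`hasDerivAt_tmplF`, `hasDerivAt_tmplG`), continuity, `F = G = 0` on `(−∞,1]`;
* the decompositions **`NF(L) = Re ℓ₁(L) + Σ_𝒮 Re ℓ_ω(L) − Σ_ℛ Re ℓ_ρ(L) + M Re ℓ_δ(L)`** (`NF_eq`, with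
  `ℓ_z = liKernel z`, BDR (2.6)) and **`NG(log x) = (x − 1) + Σ_𝒮 Re(x^ω − 1) − Σ_ℛ Re(x^ρ − 1) + M(x^δ − 1)`** (`NG_log_eq`);
* **Lemma 3.1** (`exists_M0_NF_pos`): if `Re ω, Re ρ < 1` and `0 < δ`, there is `M₀` such that for `M ≥ M₀`,
  `NF(log x) > 0` for all `x > 1` (so `F` is strictly increasing) — large `x`: `NF₀(log x) ≥ x/2`
  (`exists_X0_half_le_NF0`, from `Literature.NumberTheory.BeurlingPrimes.abs_re_liKernel_sub_le`); small `x`: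
  `|NF₀(L)| ≤ B(e^{QL} − 1) ≤ BQe^{QL₀} L` against `M Re ℓ_δ(L) ≥ MδL/2`;
* the Chebyshev-type upper bounds `NF(log x) ≤ C x`, `|NG(log x)| ≤ C x` (`x ≥ 1`) and `|NF(L)|, |NG(L)| ≤ B'(e^{QL} − 1)`.

## References
* [BrouckeDebruyneRevesz2023] F. Broucke, G. Debruyne, Sz. Gy. Révész, *Some examples of well-behaved Beurling
  number systems*, arXiv:2309.01567, §2 (2.3)–(2.7), Lemma 3.1 and its proof, proof of Theorem 3.2 (read).
-/

noncomputable section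

open Filter Topology Complex Set
open scoped Nat

namespace Literature.NumberTheory.BeurlingPrimes

/-! ### Generic facts on `logSeries` -/

section LogSeriesAux

variable {c d : ℕ → ℝ} {A R : ℝ}

/-- The zero series. [folklore] -/
theorem logSeries_zero_fun (L : ℝ) : logSeries (fun _ ↦ (0 : ℝ)) L = 0 := by
  simp [logSeries]

/-- `logSeries (c − d) = logSeries c − logSeries d`. [folklore] -/
theorem logSeries_sub {B S : ℝ} (hA : 0 ≤ A) (hc : ∀ n, |c n| ≤ A * R ^ n) (hB : 0 ≤ B)
    (hd : ∀ n, |d n| ≤ B * S ^ n) (L : ℝ) :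
    logSeries (fun n ↦ c n - d n) L = logSeries c L - logSeries d L := by
  have hd' : ∀ n, |(-1) * d n| ≤ B * S ^ n := fun n ↦ by rw [neg_one_mul, abs_neg]; exact hd n
  have h := logSeries_add hA hc hB hd' L
  rw [logSeries_const_mul] at h
  simp only [neg_one_mul, ← sub_eq_add_neg] at h
  exact h

/-- **`L · Σ c(n+1) Lⁿ/n! = Σ n c(n) Lⁿ/n!`**: the chain-rule identity behind `x log x · F′(x)` for
`F = logSeries c ∘ log` (BDR (2.6): "obtained by termwise differentiation"). [cite: BrouckeDebruyneRevesz2023, §2 (2.6)] -/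
theorem mul_logSeries_succ_eq (hA : 0 ≤ A) (hc : ∀ n, |c n| ≤ A * R ^ n) (L : ℝ) :
    L * logSeries (fun n ↦ c (n + 1)) L = logSeries (fun n ↦ n * c n) L := by
  have hc' : ∀ n, |c (n + 1)| ≤ A * |R| * |R| ^ n := shift_bound hA hc
  have h1 := (hasSum_logSeries (by positivity) hc' L).mul_left L
  have h2 : HasSum (fun m : ℕ ↦ (m : ℝ) * c m * L ^ m / m !) (L * logSeries (fun n ↦ c (n + 1)) L) := by
    rw [← hasSum_nat_add_iff' 1]
    simp only [Finset.range_one, Finset.sum_singleton, Nat.cast_zero, zero_mul, zero_div, sub_zero]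
    refine h1.congr_fun fun n ↦ ?_
    rw [Nat.factorial_succ, Nat.cast_mul, pow_succ]
    push_cast
    have hf : (n ! : ℝ) ≠ 0 := by positivity
    have hn : (n : ℝ) + 1 ≠ 0 := by positivity
    field_simp
  rw [← h2.tsum_eq, logSeries]

/-- `n ≤ 2ⁿ` bound turning `|n c n| ≤ A n Rⁿ` into a geometric bound: `|n c n| ≤ A (2|R|)ⁿ`. [folklore] -/
theorem abs_natCast_mul_le (hA : 0 ≤ A) (hc : ∀ n, |c n| ≤ A * R ^ n) (n : ℕ) :
    |(n : ℝ) * c n| ≤ A * (2 * |R|) ^ n := by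
  rw [abs_mul, Nat.abs_cast, mul_pow, ← abs_pow]
  have h1 : (n : ℝ) ≤ 2 ^ n := by exact_mod_cast (Nat.lt_two_pow_self).le
  have h2 : |c n| ≤ A * |R ^ n| := (hc n).trans (mul_le_mul_of_nonneg_left (le_abs_self _) hA)
  calc (n : ℝ) * |c n| ≤ 2 ^ n * (A * |R ^ n|) := mul_le_mul h1 h2 (abs_nonneg _) (by positivity)
    _ = A * (2 ^ n * |R ^ n|) := by ring

/-- `|logSeries c L| ≤ B (e^{Q|L|} − 1)` when `|c n| ≤ B Qⁿ` for `n ≥ 1` and `c 0 = 0` (`B, Q ≥ 0`). [folklore] -/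
theorem abs_logSeries_le_exp_sub_one {B Q : ℝ} (hB : 0 ≤ B) (hQ : 0 ≤ Q) (hc0 : c 0 = 0)
    (hc : ∀ n, |c n| ≤ B * Q ^ n) (L : ℝ) : |logSeries c L| ≤ B * (Real.exp (Q * |L|) - 1) := by
  have hd : ∀ n, |(if n = 0 then (0 : ℝ) else B * Q ^ n)| ≤ B * Q ^ n := fun n ↦ by
    split_ifs
    · simp; positivity
    · rw [abs_of_nonneg (by positivity)]
  have hcd : ∀ n, |c n| ≤ (if n = 0 then (0 : ℝ) else B * Q ^ n) := fun n ↦ by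
    split_ifs with h
    · rw [h, hc0, abs_zero]
    · exact hc n
  have h := abs_logSeries_le hB hc hB hd hcd L
  refine h.trans (le_of_eq ?_)
  have h2 := ((real_hasSum_ite_pow_div_factorial (Q * |L|)).mul_left B).tsum_eq
  rw [logSeries, ← h2]
  refine tsum_congr fun n ↦ ?_
  split_ifs <;> simp [mul_pow]; ring

end LogSeriesAux

/-! ### Multiset sums of `logSeries` -/

section MultisetAux

/-- Linearity of `logSeries` over a multiset of complex exponents: for a real weight `w` with `|w n| ≤ 1` and
`‖z‖ ≤ Q` on `X`, `logSeries (n ↦ w n · Re Σ_{z∈X} zⁿ) L = Σ_{z∈X} logSeries (n ↦ w n · Re zⁿ) L`. [folklore] -/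
theorem logSeries_multiset_re (X : Multiset ℂ) (w : ℕ → ℝ) (hw : ∀ n, |w n| ≤ 1) {Q : ℝ}
    (hX : ∀ z ∈ X, ‖z‖ ≤ Q) (L : ℝ) :
    logSeries (fun n ↦ w n * ((X.map (· ^ n)).sum).re) L = (X.map fun z ↦ logSeries (fun n ↦ w n * (z ^ n).re) L).sum := by
  induction X using Multiset.induction_on with
  | empty => simp [logSeries_zero_fun]
  | cons a X ih =>
    have haX : ∀ z ∈ X, ‖z‖ ≤ Q := fun z hz ↦ hX z (Multiset.mem_cons_of_mem hz)
    have ha : ‖a‖ ≤ Q := hX a (Multiset.mem_cons_self a X)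
    simp only [Multiset.map_cons, Multiset.sum_cons, Complex.add_re, mul_add]
    -- bounds for `logSeries_add`
    have hca : ∀ n, |w n * (a ^ n).re| ≤ 1 * Q ^ n := fun n ↦ by
      rw [abs_mul, one_mul]
      calc |w n| * |(a ^ n).re| ≤ 1 * ‖a ^ n‖ := mul_le_mul (hw n) (abs_re_le_norm _) (abs_nonneg _) zero_le_one
        _ ≤ Q ^ n := by rw [one_mul, norm_pow]; exact pow_le_pow_left₀ (norm_nonneg _) ha n
    have hcX : ∀ n, |w n * ((X.map (· ^ n)).sum).re| ≤ (Multiset.card X : ℝ) * Q ^ n := fun n ↦ by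
      rw [abs_mul]
      have h1 : |((X.map (· ^ n)).sum).re| ≤ (Multiset.card X : ℝ) * Q ^ n := by
        refine (abs_re_le_norm _).trans ((norm_multiset_sum_le _).trans ?_)
        rw [Multiset.map_map]
        have h2 : ∀ y ∈ X.map (fun z ↦ ‖z ^ n‖), y ≤ Q ^ n := by
          intro y hy
          obtain ⟨z, hz, rfl⟩ := Multiset.mem_map.1 hy
          rw [norm_pow]; exact pow_le_pow_left₀ (norm_nonneg _) (haX z hz) n
        have h3 := Multiset.sum_le_card_nsmul _ _ h2
        rw [Multiset.card_map, nsmul_eq_mul] at h3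
        exact h3
      calc |w n| * |((X.map (· ^ n)).sum).re| ≤ 1 * ((Multiset.card X : ℝ) * Q ^ n) :=
            mul_le_mul (hw n) h1 (abs_nonneg _) zero_le_one
        _ = (Multiset.card X : ℝ) * Q ^ n := one_mul _
    rw [logSeries_add zero_le_one hca (Nat.cast_nonneg _) hcX, ih haX]

end MultisetAux

namespace BDRMultiset

variable (R S : Multiset ℂ) (δ : ℝ) (M : ℕ)

/-! ### Coefficients and the template functions -/

/-- `Q = 1 + Σ_𝒮 ‖ω‖ + Σ_ℛ ‖ρ‖`, a common bound `≥ 1` for the moduli of all exponents. [folklore] -/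
def normBound : ℝ := 1 + (S.map fun z ↦ ‖z‖).sum + (R.map fun z ↦ ‖z‖).sum

/-- `B = 1 + |𝒮| + |ℛ| + M`. [folklore] -/
def sizeBound : ℝ := 1 + Multiset.card S + Multiset.card R + M

/-- **`A n = 1 + Re Σ_𝒮 ωⁿ − Re Σ_ℛ ρⁿ + M δⁿ`**, the `n`-th power sum of the exponents (real part).
[cite: BrouckeDebruyneRevesz2023, Lemma 3.1 (3.1)] -/
def powCoeff (n : ℕ) : ℝ := 1 + ((S.map (· ^ n)).sum).re - ((R.map (· ^ n)).sum).re + M * δ ^ n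

/-- Coefficients of `F`: `A n/(n ζ(n+1))` (`n ≥ 1`). [cite: BrouckeDebruyneRevesz2023, §2 (2.4)] -/
def cF (n : ℕ) : ℝ := if n = 0 then 0 else invZetaCoeff n * powCoeff R S δ M n / n

/-- Coefficients of `G`: `A n/n` (`n ≥ 1`). [cite: BrouckeDebruyneRevesz2023, §2 (2.3)] -/
def cG (n : ℕ) : ℝ := if n = 0 then 0 else powCoeff R S δ M n / n

/-- Coefficients of `NF = x log x F′`: `A n/ζ(n+1)` (`invZetaCoeff 0 = 0`). [cite: BrouckeDebruyneRevesz2023, §2 (2.6)] -/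
def cNF (n : ℕ) : ℝ := invZetaCoeff n * powCoeff R S δ M n

/-- Coefficients of `NG = x log x G′`: `A n` (`n ≥ 1`). [cite: BrouckeDebruyneRevesz2023, §2 (2.5)] -/
def cNG (n : ℕ) : ℝ := if n = 0 then 0 else powCoeff R S δ M n

/-- **The template `F(x) = li(x) + Σ_𝒮 li(x^ω) − Σ_ℛ li(x^ρ) + M li(x^δ)`** (real-part form), `0` for `x ≤ 1`.
[cite: BrouckeDebruyneRevesz2023, Lemma 3.1 (3.1)] -/
def tmplF (x : ℝ) : ℝ := logSeries (cF R S δ M) (Real.log (max x 1))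

/-- **The companion `G(x) = Li(x) + Σ_𝒮 Li(x^ω) − Σ_ℛ Li(x^ρ) + M Li(x^δ)`** (real-part form), `0` for `x ≤ 1`.
[cite: BrouckeDebruyneRevesz2023, proof of Theorem 3.2 (3.3)] -/
def tmplG (x : ℝ) : ℝ := logSeries (cG R S δ M) (Real.log (max x 1))

/-- `NF(L) = Σ A n Lⁿ/(n! ζ(n+1))` (`= x log x F′(x)` at `L = log x`). [cite: BrouckeDebruyneRevesz2023, §2 (2.6)] -/
def NF (L : ℝ) : ℝ := logSeries (cNF R S δ M) L

/-- `NG(L) = Σ_{n≥1} A n Lⁿ/n!` (`= x log x G′(x)` at `L = log x`). [cite: BrouckeDebruyneRevesz2023, §2 (2.5)] -/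
def NG (L : ℝ) : ℝ := logSeries (cNG R S δ M) L

/-- The density `f = F′`: `NF(log u)/(u log u)` for `u > 1`, `0` otherwise. [cite: BrouckeDebruyneRevesz2023, proof of Theorem 3.2] -/
def densF (u : ℝ) : ℝ := if 1 < u then NF R S δ M (Real.log u) / (u * Real.log u) else 0

/-- The density `g = G′`: `NG(log u)/(u log u)` for `u > 1`, `0` otherwise. [cite: BrouckeDebruyneRevesz2023, proof of Theorem 3.2] -/
def densG (u : ℝ) : ℝ := if 1 < u then NG R S δ M (Real.log u) / (u * Real.log u) else 0

variable {R S δ M}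

/-! ### Coefficient bounds -/

/-- `1 ≤ Q`. [folklore] -/
theorem one_le_normBound : 1 ≤ normBound R S := by
  unfold normBound
  have h1 : 0 ≤ (S.map fun z ↦ ‖z‖).sum := Multiset.sum_nonneg fun y hy ↦ by
    obtain ⟨z, _, rfl⟩ := Multiset.mem_map.1 hy; exact norm_nonneg _
  have h2 : 0 ≤ (R.map fun z ↦ ‖z‖).sum := Multiset.sum_nonneg fun y hy ↦ by
    obtain ⟨z, _, rfl⟩ := Multiset.mem_map.1 hy; exact norm_nonneg _
  linarith

/-- `0 ≤ Q`. [folklore] -/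
theorem normBound_nonneg : 0 ≤ normBound R S := zero_le_one.trans one_le_normBound

/-- `‖ω‖ ≤ Q` for `ω ∈ 𝒮`. [folklore] -/
theorem norm_le_normBound_of_mem_S {z : ℂ} (hz : z ∈ S) : ‖z‖ ≤ normBound R S := by
  unfold normBound
  have h1 : ‖z‖ ≤ (S.map fun z ↦ ‖z‖).sum :=
    Multiset.single_le_sum (fun y hy ↦ by obtain ⟨w, _, rfl⟩ := Multiset.mem_map.1 hy; exact norm_nonneg _) _
      (Multiset.mem_map_of_mem _ hz)
  have h2 : 0 ≤ (R.map fun z ↦ ‖z‖).sum := Multiset.sum_nonneg fun y hy ↦ by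
    obtain ⟨w, _, rfl⟩ := Multiset.mem_map.1 hy; exact norm_nonneg _
  linarith

/-- `‖ρ‖ ≤ Q` for `ρ ∈ ℛ`. [folklore] -/
theorem norm_le_normBound_of_mem_R {z : ℂ} (hz : z ∈ R) : ‖z‖ ≤ normBound R S := by
  unfold normBound
  have h1 : ‖z‖ ≤ (R.map fun z ↦ ‖z‖).sum :=
    Multiset.single_le_sum (fun y hy ↦ by obtain ⟨w, _, rfl⟩ := Multiset.mem_map.1 hy; exact norm_nonneg _) _
      (Multiset.mem_map_of_mem _ hz)
  have h2 : 0 ≤ (S.map fun z ↦ ‖z‖).sum := Multiset.sum_nonneg fun y hy ↦ by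
    obtain ⟨w, _, rfl⟩ := Multiset.mem_map.1 hy; exact norm_nonneg _
  linarith

/-- `1 ≤ B`. [folklore] -/
theorem one_le_sizeBound : 1 ≤ sizeBound R S M := by
  unfold sizeBound
  have : 0 ≤ (Multiset.card S : ℝ) + Multiset.card R + M := by positivity
  linarith

/-- `0 ≤ B`. [folklore] -/
theorem sizeBound_nonneg : 0 ≤ sizeBound R S M := zero_le_one.trans one_le_sizeBound

/-- `|Re Σ_{z∈X} zⁿ| ≤ |X| Qⁿ` when `‖z‖ ≤ Q` on `X`. [folklore] -/
theorem abs_re_sum_pow_le (X : Multiset ℂ) {Q : ℝ} (hX : ∀ z ∈ X, ‖z‖ ≤ Q) (n : ℕ) :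
    |((X.map (· ^ n)).sum).re| ≤ (Multiset.card X : ℝ) * Q ^ n := by
  refine (abs_re_le_norm _).trans ((norm_multiset_sum_le _).trans ?_)
  rw [Multiset.map_map]
  have h2 : ∀ y ∈ X.map (fun z ↦ ‖z ^ n‖), y ≤ Q ^ n := by
    intro y hy
    obtain ⟨z, hz, rfl⟩ := Multiset.mem_map.1 hy
    rw [norm_pow]; exact pow_le_pow_left₀ (norm_nonneg _) (hX z hz) n
  have h3 := Multiset.sum_le_card_nsmul _ _ h2
  rw [Multiset.card_map, nsmul_eq_mul] at h3
  exact h3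

/-- **`|A n| ≤ B Qⁿ`** (for `0 ≤ δ ≤ 1`). [folklore] -/
theorem abs_powCoeff_le (hδ : 0 ≤ δ) (hδ1 : δ ≤ 1) (n : ℕ) :
    |powCoeff R S δ M n| ≤ sizeBound R S M * normBound R S ^ n := by
  have hQ := one_le_normBound (R := R) (S := S)
  have hQn : 1 ≤ normBound R S ^ n := one_le_pow₀ hQ
  have hS := abs_re_sum_pow_le S (fun z hz ↦ norm_le_normBound_of_mem_S (R := R) hz) n
  have hR := abs_re_sum_pow_le R (fun z hz ↦ norm_le_normBound_of_mem_R (S := S) hz) n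
  have hδn : |(M : ℝ) * δ ^ n| ≤ M * normBound R S ^ n := by
    rw [abs_mul, Nat.abs_cast, abs_of_nonneg (pow_nonneg hδ n)]
    exact mul_le_mul_of_nonneg_left ((pow_le_one₀ hδ hδ1).trans hQn) (Nat.cast_nonneg _)
  unfold powCoeff sizeBound
  calc |1 + ((S.map (· ^ n)).sum).re - ((R.map (· ^ n)).sum).re + M * δ ^ n|
      ≤ |(1 : ℝ)| + |((S.map (· ^ n)).sum).re| + |((R.map (· ^ n)).sum).re| + |(M : ℝ) * δ ^ n| := by
        have := abs_add_le (1 + ((S.map (· ^ n)).sum).re - ((R.map (· ^ n)).sum).re) ((M : ℝ) * δ ^ n)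
        have := abs_sub (1 + ((S.map (· ^ n)).sum).re) ((R.map (· ^ n)).sum).re
        have := abs_add_le (1 : ℝ) ((S.map (· ^ n)).sum).re
        linarith
    _ ≤ 1 * normBound R S ^ n + Multiset.card S * normBound R S ^ n + Multiset.card R * normBound R S ^ n +
          M * normBound R S ^ n := by
        rw [abs_one]; linarith
    _ = (1 + Multiset.card S + Multiset.card R + M) * normBound R S ^ n := by ring

/-- `|cNF n| ≤ B Qⁿ`. [folklore] -/
theorem abs_cNF_le (hδ : 0 ≤ δ) (hδ1 : δ ≤ 1) (n : ℕ) : |cNF R S δ M n| ≤ sizeBound R S M * normBound R S ^ n := by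
  unfold cNF
  rw [abs_mul]
  calc |invZetaCoeff n| * |powCoeff R S δ M n| ≤ 1 * (sizeBound R S M * normBound R S ^ n) :=
        mul_le_mul (abs_invZetaCoeff_le_one n) (abs_powCoeff_le hδ hδ1 n) (abs_nonneg _) zero_le_one
    _ = _ := one_mul _

/-- `|cNG n| ≤ B Qⁿ`. [folklore] -/
theorem abs_cNG_le (hδ : 0 ≤ δ) (hδ1 : δ ≤ 1) (n : ℕ) : |cNG R S δ M n| ≤ sizeBound R S M * normBound R S ^ n := by
  unfold cNG; split_ifs
  · simp; exact mul_nonneg sizeBound_nonneg (pow_nonneg normBound_nonneg n)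
  · exact abs_powCoeff_le hδ hδ1 n

/-- `|A n/n| ≤ |A n|`-type bound: `|cG n| ≤ B Qⁿ`. [folklore] -/
theorem abs_cG_le (hδ : 0 ≤ δ) (hδ1 : δ ≤ 1) (n : ℕ) : |cG R S δ M n| ≤ sizeBound R S M * normBound R S ^ n := by
  unfold cG; split_ifs with h
  · simp; exact mul_nonneg sizeBound_nonneg (pow_nonneg normBound_nonneg n)
  · rw [abs_div, Nat.abs_cast]
    exact (div_le_self (abs_nonneg _) (by exact_mod_cast Nat.one_le_iff_ne_zero.2 h)).trans (abs_powCoeff_le hδ hδ1 n)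

/-- `|cF n| ≤ B Qⁿ`. [folklore] -/
theorem abs_cF_le (hδ : 0 ≤ δ) (hδ1 : δ ≤ 1) (n : ℕ) : |cF R S δ M n| ≤ sizeBound R S M * normBound R S ^ n := by
  unfold cF; split_ifs with h
  · simp; exact mul_nonneg sizeBound_nonneg (pow_nonneg normBound_nonneg n)
  · rw [abs_div, Nat.abs_cast, abs_mul]
    have h1 : |invZetaCoeff n| * |powCoeff R S δ M n| ≤ 1 * (sizeBound R S M * normBound R S ^ n) :=
      mul_le_mul (abs_invZetaCoeff_le_one n) (abs_powCoeff_le hδ hδ1 n) (abs_nonneg _) zero_le_one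
    rw [one_mul] at h1
    exact (div_le_self (by positivity) (by exact_mod_cast Nat.one_le_iff_ne_zero.2 h)).trans h1

/-- `cNF n = n · cF n`. [folklore] -/
theorem cNF_eq_mul_cF (n : ℕ) : cNF R S δ M n = n * cF R S δ M n := by
  unfold cNF cF
  rcases Nat.eq_zero_or_pos n with rfl | hn
  · simp [invZetaCoeff]
  · rw [if_neg hn.ne']
    have : (n : ℝ) ≠ 0 := by exact_mod_cast hn.ne'
    field_simp

/-- `cNG n = n · cG n`. [folklore] -/
theorem cNG_eq_mul_cG (n : ℕ) : cNG R S δ M n = n * cG R S δ M n := by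
  unfold cNG cG
  rcases Nat.eq_zero_or_pos n with rfl | hn
  · simp
  · rw [if_neg hn.ne', if_neg hn.ne']
    have : (n : ℝ) ≠ 0 := by exact_mod_cast hn.ne'
    field_simp

/-! ### Values at `x ≤ 1`, continuity and derivatives -/

/-- `F = 0` on `(−∞, 1]`. [cite: BrouckeDebruyneRevesz2023, Lemma 3.1] -/
theorem tmplF_of_le_one {x : ℝ} (hx : x ≤ 1) : tmplF R S δ M x = 0 := by
  rw [tmplF, max_eq_right hx, Real.log_one, logSeries_zero]; simp [cF]

/-- `G = 0` on `(−∞, 1]`. [cite: BrouckeDebruyneRevesz2023, proof of Theorem 3.2] -/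
theorem tmplG_of_le_one {x : ℝ} (hx : x ≤ 1) : tmplG R S δ M x = 0 := by
  rw [tmplG, max_eq_right hx, Real.log_one, logSeries_zero]; simp [cG]

/-- `F(x) = logSeries cF (log x)` for `x ≥ 1`. [folklore] -/
theorem tmplF_of_one_le {x : ℝ} (hx : 1 ≤ x) : tmplF R S δ M x = logSeries (cF R S δ M) (Real.log x) := by
  rw [tmplF, max_eq_left hx]

/-- `G(x) = logSeries cG (log x)` for `x ≥ 1`. [folklore] -/
theorem tmplG_of_one_le {x : ℝ} (hx : 1 ≤ x) : tmplG R S δ M x = logSeries (cG R S δ M) (Real.log x) := by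
  rw [tmplG, max_eq_left hx]

/-- `NF(0) = 0`. [folklore] -/
theorem NF_zero : NF R S δ M 0 = 0 := by rw [NF, logSeries_zero]; simp [cNF, invZetaCoeff]

/-- `NG(0) = 0`. [folklore] -/
theorem NG_zero : NG R S δ M 0 = 0 := by rw [NG, logSeries_zero]; simp [cNG]

/-- `F` is continuous (for `0 ≤ δ ≤ 1`). [cite: BrouckeDebruyneRevesz2023, Lemma 3.1] -/
theorem continuous_tmplF (hδ : 0 ≤ δ) (hδ1 : δ ≤ 1) : Continuous (tmplF R S δ M) := by
  have h := continuous_logSeries sizeBound_nonneg (abs_cF_le (R := R) (S := S) (M := M) hδ hδ1)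
  exact h.comp ((continuous_id.max continuous_const).log fun x ↦
    ne_of_gt (lt_of_lt_of_le one_pos (le_max_right x 1)))

/-- `G` is continuous (for `0 ≤ δ ≤ 1`). [cite: BrouckeDebruyneRevesz2023, proof of Theorem 3.2] -/
theorem continuous_tmplG (hδ : 0 ≤ δ) (hδ1 : δ ≤ 1) : Continuous (tmplG R S δ M) := by
  have h := continuous_logSeries sizeBound_nonneg (abs_cG_le (R := R) (S := S) (M := M) hδ hδ1)
  exact h.comp ((continuous_id.max continuous_const).log fun x ↦
    ne_of_gt (lt_of_lt_of_le one_pos (le_max_right x 1)))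

/-- `NF` is continuous. [folklore] -/
theorem continuous_NF (hδ : 0 ≤ δ) (hδ1 : δ ≤ 1) : Continuous (NF R S δ M) :=
  continuous_logSeries sizeBound_nonneg (abs_cNF_le (R := R) (S := S) (M := M) hδ hδ1)

/-- `NG` is continuous. [folklore] -/
theorem continuous_NG (hδ : 0 ≤ δ) (hδ1 : δ ≤ 1) : Continuous (NG R S δ M) :=
  continuous_logSeries sizeBound_nonneg (abs_cNG_le (R := R) (S := S) (M := M) hδ hδ1)

/-- **`F′(x) = NF(log x)/(x log x)` for `x > 1`.** [cite: BrouckeDebruyneRevesz2023, §2 (2.6)] -/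
theorem hasDerivAt_tmplF (hδ : 0 ≤ δ) (hδ1 : δ ≤ 1) {x : ℝ} (hx : 1 < x) :
    HasDerivAt (tmplF R S δ M) (densF R S δ M x) x := by
  have hx0 : x ≠ 0 := by positivity
  have hlog : Real.log x ≠ 0 := (Real.log_pos hx).ne'
  have hc := abs_cF_le (R := R) (S := S) (M := M) hδ hδ1
  have h1 := hasDerivAt_logSeries_log sizeBound_nonneg hc hx0
  have heq : (fun y ↦ logSeries (cF R S δ M) (Real.log y)) =ᶠ[𝓝 x] tmplF R S δ M := by
    filter_upwards [Ioi_mem_nhds hx] with y hy using (tmplF_of_one_le (le_of_lt hy)).symm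
  have h2 := h1.congr_of_eventuallyEq heq.symm
  have hNF : NF R S δ M (Real.log x) = Real.log x * logSeries (fun n ↦ cF R S δ M (n + 1)) (Real.log x) := by
    rw [NF, mul_logSeries_succ_eq sizeBound_nonneg hc]
    congr 1; funext n; exact cNF_eq_mul_cF n
  rw [densF, if_pos hx, hNF]
  have : Real.log x * logSeries (fun n ↦ cF R S δ M (n + 1)) (Real.log x) / (x * Real.log x) =
      logSeries (fun n ↦ cF R S δ M (n + 1)) (Real.log x) * x⁻¹ := by field_simp
  rw [this]; exact h2

/-- **`G′(x) = NG(log x)/(x log x)` for `x > 1`.** [cite: BrouckeDebruyneRevesz2023, §2 (2.5)] -/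
theorem hasDerivAt_tmplG (hδ : 0 ≤ δ) (hδ1 : δ ≤ 1) {x : ℝ} (hx : 1 < x) :
    HasDerivAt (tmplG R S δ M) (densG R S δ M x) x := by
  have hx0 : x ≠ 0 := by positivity
  have hlog : Real.log x ≠ 0 := (Real.log_pos hx).ne'
  have hc := abs_cG_le (R := R) (S := S) (M := M) hδ hδ1
  have h1 := hasDerivAt_logSeries_log sizeBound_nonneg hc hx0
  have heq : (fun y ↦ logSeries (cG R S δ M) (Real.log y)) =ᶠ[𝓝 x] tmplG R S δ M := by
    filter_upwards [Ioi_mem_nhds hx] with y hy using (tmplG_of_one_le (le_of_lt hy)).symm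
  have h2 := h1.congr_of_eventuallyEq heq.symm
  have hNG : NG R S δ M (Real.log x) = Real.log x * logSeries (fun n ↦ cG R S δ M (n + 1)) (Real.log x) := by
    rw [NG, mul_logSeries_succ_eq sizeBound_nonneg hc]
    congr 1; funext n; exact cNG_eq_mul_cG n
  rw [densG, if_pos hx, hNG]
  have : Real.log x * logSeries (fun n ↦ cG R S δ M (n + 1)) (Real.log x) / (x * Real.log x) =
      logSeries (fun n ↦ cG R S δ M (n + 1)) (Real.log x) * x⁻¹ := by field_simp
  rw [this]; exact h2

/-- `F′ = 0` at points `x < 1`. [folklore] -/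
theorem hasDerivAt_tmplF_of_lt_one {x : ℝ} (hx : x < 1) : HasDerivAt (tmplF R S δ M) (densF R S δ M x) x := by
  rw [densF, if_neg (not_lt.2 hx.le)]
  have heq : tmplF R S δ M =ᶠ[𝓝 x] fun _ ↦ (0 : ℝ) := by
    filter_upwards [Iio_mem_nhds hx] with y hy using tmplF_of_le_one (le_of_lt hy)
  exact (hasDerivAt_const x (0 : ℝ)).congr_of_eventuallyEq heq

/-- `G′ = 0` at points `x < 1`. [folklore] -/
theorem hasDerivAt_tmplG_of_lt_one {x : ℝ} (hx : x < 1) : HasDerivAt (tmplG R S δ M) (densG R S δ M x) x := by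
  rw [densG, if_neg (not_lt.2 hx.le)]
  have heq : tmplG R S δ M =ᶠ[𝓝 x] fun _ ↦ (0 : ℝ) := by
    filter_upwards [Iio_mem_nhds hx] with y hy using tmplG_of_le_one (le_of_lt hy)
  exact (hasDerivAt_const x (0 : ℝ)).congr_of_eventuallyEq heq

/-- `densF = 0` on `(−∞, 1]`. [folklore] -/
theorem densF_of_le_one {u : ℝ} (hu : u ≤ 1) : densF R S δ M u = 0 := by rw [densF, if_neg (not_lt.2 hu)]

/-- `densG = 0` on `(−∞, 1]`. [folklore] -/
theorem densG_of_le_one {u : ℝ} (hu : u ≤ 1) : densG R S δ M u = 0 := by rw [densG, if_neg (not_lt.2 hu)]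

/-- `densF u = NF(log u)/(u log u)` for `u > 1`. [folklore] -/
theorem densF_of_one_lt {u : ℝ} (hu : 1 < u) : densF R S δ M u = NF R S δ M (Real.log u) / (u * Real.log u) := by
  rw [densF, if_pos hu]

/-- `densG u = NG(log u)/(u log u)` for `u > 1`. [folklore] -/
theorem densG_of_one_lt {u : ℝ} (hu : 1 < u) : densG R S δ M u = NG R S δ M (Real.log u) / (u * Real.log u) := by
  rw [densG, if_pos hu]

/-- `densF` is continuous on `(1, ∞)`. [folklore] -/
theorem continuousOn_densF (hδ : 0 ≤ δ) (hδ1 : δ ≤ 1) : ContinuousOn (densF R S δ M) (Ioi 1) := by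
  have h : ContinuousOn (fun u ↦ NF R S δ M (Real.log u) / (u * Real.log u)) (Ioi 1) := by
    refine ContinuousOn.div ?_ ?_ fun u hu ↦ ?_
    · exact (continuous_NF hδ hδ1).comp_continuousOn
        (Real.continuousOn_log.mono fun u hu ↦ ne_of_gt (lt_trans one_pos hu))
    · exact continuousOn_id.mul (Real.continuousOn_log.mono fun u hu ↦ ne_of_gt (lt_trans one_pos hu))
    · exact mul_ne_zero (ne_of_gt (lt_trans one_pos hu)) (Real.log_pos hu).ne'
  exact h.congr fun u hu ↦ densF_of_one_lt hu

/-- `densG` is continuous on `(1, ∞)`. [folklore] -/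
theorem continuousOn_densG (hδ : 0 ≤ δ) (hδ1 : δ ≤ 1) : ContinuousOn (densG R S δ M) (Ioi 1) := by
  have h : ContinuousOn (fun u ↦ NG R S δ M (Real.log u) / (u * Real.log u)) (Ioi 1) := by
    refine ContinuousOn.div ?_ ?_ fun u hu ↦ ?_
    · exact (continuous_NG hδ hδ1).comp_continuousOn
        (Real.continuousOn_log.mono fun u hu ↦ ne_of_gt (lt_trans one_pos hu))
    · exact continuousOn_id.mul (Real.continuousOn_log.mono fun u hu ↦ ne_of_gt (lt_trans one_pos hu))
    · exact mul_ne_zero (ne_of_gt (lt_trans one_pos hu)) (Real.log_pos hu).ne'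
  exact h.congr fun u hu ↦ densG_of_one_lt hu

/-- `densF` is measurable. [folklore] -/
theorem measurable_densF (hδ : 0 ≤ δ) (hδ1 : δ ≤ 1) : Measurable (densF R S δ M) := by
  have h : densF R S δ M = (Ioi (1 : ℝ)).piecewise (fun u ↦ NF R S δ M (Real.log u) / (u * Real.log u)) 0 := by
    funext u
    by_cases hu : u ∈ Ioi (1 : ℝ)
    · rw [Set.piecewise_eq_of_mem _ _ _ hu, densF_of_one_lt hu]
    · rw [Set.piecewise_eq_of_notMem _ _ _ hu, densF_of_le_one (not_lt.1 hu)]; rfl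
  rw [h]
  refine Measurable.piecewise measurableSet_Ioi ?_ measurable_const
  exact ((continuous_NF hδ hδ1).measurable.comp Real.measurable_log).div
    (measurable_id.mul Real.measurable_log)

/-- `densG` is measurable. [folklore] -/
theorem measurable_densG (hδ : 0 ≤ δ) (hδ1 : δ ≤ 1) : Measurable (densG R S δ M) := by
  have h : densG R S δ M = (Ioi (1 : ℝ)).piecewise (fun u ↦ NG R S δ M (Real.log u) / (u * Real.log u)) 0 := by
    funext u
    by_cases hu : u ∈ Ioi (1 : ℝ)
    · rw [Set.piecewise_eq_of_mem _ _ _ hu, densG_of_one_lt hu]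
    · rw [Set.piecewise_eq_of_notMem _ _ _ hu, densG_of_le_one (not_lt.1 hu)]; rfl
  rw [h]
  refine Measurable.piecewise measurableSet_Ioi ?_ measurable_const
  exact ((continuous_NG hδ hδ1).measurable.comp Real.measurable_log).div
    (measurable_id.mul Real.measurable_log)

/-! ### The decompositions of `NF` and `NG` -/

section Decomp

variable (R S δ M)

/-- Bounds of the four coefficient pieces against `logSeries_add`. [folklore] -/
theorem pieces_bounds (w : ℕ → ℝ) (hw1 : ∀ n, |w n| ≤ 1) :
    (∀ n, |w n * ((1 : ℂ) ^ n).re| ≤ 1 * normBound R S ^ n) ∧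
    (∀ n, |w n * ((S.map (· ^ n)).sum).re| ≤ (Multiset.card S : ℝ) * normBound R S ^ n) ∧
    (∀ n, |w n * ((R.map (· ^ n)).sum).re| ≤ (Multiset.card R : ℝ) * normBound R S ^ n) ∧
    (∀ n, |(M : ℝ) * (w n * δ ^ n)| ≤ M * |δ| ^ n) ∧
    (∀ n, |w n * ((1 : ℂ) ^ n).re + w n * ((S.map (· ^ n)).sum).re| ≤
      (1 + Multiset.card S) * normBound R S ^ n) ∧
    (∀ n, |w n * ((1 : ℂ) ^ n).re + w n * ((S.map (· ^ n)).sum).re - w n * ((R.map (· ^ n)).sum).re| ≤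
      (1 + Multiset.card S + Multiset.card R) * normBound R S ^ n) := by
  have hQn : ∀ n, 1 ≤ normBound R S ^ n := fun n ↦ one_le_pow₀ one_le_normBound
  have b1 : ∀ n, |w n * ((1 : ℂ) ^ n).re| ≤ 1 * normBound R S ^ n := fun n ↦ by
    rw [one_pow, Complex.one_re, mul_one, one_mul]; exact (hw1 n).trans (hQn n)
  have bS : ∀ n, |w n * ((S.map (· ^ n)).sum).re| ≤ (Multiset.card S : ℝ) * normBound R S ^ n := fun n ↦ by
    rw [abs_mul]
    calc |w n| * |((S.map (· ^ n)).sum).re| ≤ 1 * ((Multiset.card S : ℝ) * normBound R S ^ n) :=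
          mul_le_mul (hw1 n) (abs_re_sum_pow_le S (fun z hz ↦ norm_le_normBound_of_mem_S (R := R) hz) n)
            (abs_nonneg _) zero_le_one
      _ = _ := one_mul _
  have bR : ∀ n, |w n * ((R.map (· ^ n)).sum).re| ≤ (Multiset.card R : ℝ) * normBound R S ^ n := fun n ↦ by
    rw [abs_mul]
    calc |w n| * |((R.map (· ^ n)).sum).re| ≤ 1 * ((Multiset.card R : ℝ) * normBound R S ^ n) :=
          mul_le_mul (hw1 n) (abs_re_sum_pow_le R (fun z hz ↦ norm_le_normBound_of_mem_R (S := S) hz) n)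
            (abs_nonneg _) zero_le_one
      _ = _ := one_mul _
  have bMδ : ∀ n, |(M : ℝ) * (w n * δ ^ n)| ≤ M * |δ| ^ n := fun n ↦ by
    rw [abs_mul, Nat.abs_cast, abs_mul, abs_pow]
    calc (M : ℝ) * (|w n| * |δ| ^ n) ≤ M * (1 * |δ| ^ n) :=
          mul_le_mul_of_nonneg_left (mul_le_mul_of_nonneg_right (hw1 n) (by positivity)) (Nat.cast_nonneg _)
      _ = _ := by ring
  have b12 : ∀ n, |w n * ((1 : ℂ) ^ n).re + w n * ((S.map (· ^ n)).sum).re| ≤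
      (1 + Multiset.card S) * normBound R S ^ n := fun n ↦ by
    have h1 := b1 n; have h2 := bS n
    calc _ ≤ |w n * ((1 : ℂ) ^ n).re| + |w n * ((S.map (· ^ n)).sum).re| := abs_add_le _ _
      _ ≤ 1 * normBound R S ^ n + (Multiset.card S : ℝ) * normBound R S ^ n := add_le_add h1 h2
      _ = _ := by ring
  have b123 : ∀ n, |w n * ((1 : ℂ) ^ n).re + w n * ((S.map (· ^ n)).sum).re - w n * ((R.map (· ^ n)).sum).re| ≤
      (1 + Multiset.card S + Multiset.card R) * normBound R S ^ n := fun n ↦ by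
    have h1 := b12 n; have h2 := bR n
    calc _ ≤ |w n * ((1 : ℂ) ^ n).re + w n * ((S.map (· ^ n)).sum).re| + |w n * ((R.map (· ^ n)).sum).re| :=
          abs_sub _ _
      _ ≤ (1 + Multiset.card S) * normBound R S ^ n + (Multiset.card R : ℝ) * normBound R S ^ n := add_le_add h1 h2
      _ = _ := by ring
  exact ⟨b1, bS, bR, bMδ, b12, b123⟩

/-- Linear combination of `logSeries` along the template, for a weight `|w| ≤ 1`. [folklore] -/
theorem logSeries_template (w : ℕ → ℝ) (hw1 : ∀ n, |w n| ≤ 1) (L : ℝ) :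
    logSeries (fun n ↦ w n * powCoeff R S δ M n) L =
      logSeries (fun n ↦ w n * ((1 : ℂ) ^ n).re) L + (S.map fun z ↦ logSeries (fun n ↦ w n * (z ^ n).re) L).sum -
      (R.map fun z ↦ logSeries (fun n ↦ w n * (z ^ n).re) L).sum + M * logSeries (fun n ↦ w n * δ ^ n) L := by
  obtain ⟨b1, bS, bR, bMδ, b12, b123⟩ := pieces_bounds R S δ M w hw1
  have eS := logSeries_multiset_re S w hw1 (fun z hz ↦ norm_le_normBound_of_mem_S (R := R) hz) L
  have eR := logSeries_multiset_re R w hw1 (fun z hz ↦ norm_le_normBound_of_mem_R (S := S) hz) L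
  have hsplit : (fun n ↦ w n * powCoeff R S δ M n) = fun n ↦ ((w n * ((1 : ℂ) ^ n).re + w n * ((S.map (· ^ n)).sum).re) -
      w n * ((R.map (· ^ n)).sum).re) + (M : ℝ) * (w n * δ ^ n) := by
    funext n; simp only [powCoeff, one_pow, Complex.one_re]; ring
  rw [hsplit, logSeries_add (by positivity) b123 (Nat.cast_nonneg _) bMδ,
    logSeries_sub (by positivity) b12 (Nat.cast_nonneg _) bR, logSeries_add zero_le_one b1 (Nat.cast_nonneg _) bS,
    logSeries_const_mul, eS, eR]

/-- **`NF(L) = Re ℓ₁(L) + Σ_𝒮 Re ℓ_ω(L) − Σ_ℛ Re ℓ_ρ(L) + M Re ℓ_δ(L)`** with `ℓ_z = liKernel z` (BDR (2.6) summed over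
the template (3.1)). [cite: BrouckeDebruyneRevesz2023, §2 (2.6) and Lemma 3.1 (3.1)] -/
theorem NF_eq (L : ℝ) :
    NF R S δ M L = (liKernel 1 L).re + (S.map fun ω ↦ (liKernel ω L).re).sum - (R.map fun ρ ↦ (liKernel ρ L).re).sum +
      M * (liKernel δ L).re := by
  have h := logSeries_template R S δ M invZetaCoeff abs_invZetaCoeff_le_one L
  have hNF : NF R S δ M L = logSeries (fun n ↦ invZetaCoeff n * powCoeff R S δ M n) L := rfl
  rw [hNF, h]
  simp only [← re_liKernel_eq_logSeries, ← re_liKernel_ofReal]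

/-- The weight `[n ≥ 1]`. [folklore] -/
theorem abs_ite_le_one (n : ℕ) : |(if n = 0 then (0 : ℝ) else 1)| ≤ 1 := by split_ifs <;> simp

/-- **`NG(L) = Re(e^{L} − 1) + Σ_𝒮 Re(e^{ωL} − 1) − Σ_ℛ Re(e^{ρL} − 1) + M(e^{δL} − 1)`** (BDR (2.5) for `Li`, summed).
[cite: BrouckeDebruyneRevesz2023, §2 (2.5)] -/
theorem NG_eq (L : ℝ) :
    NG R S δ M L = (Complex.exp ((1 : ℂ) * L) - 1).re + (S.map fun ω ↦ (Complex.exp (ω * L) - 1).re).sum -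
      (R.map fun ρ ↦ (Complex.exp (ρ * L) - 1).re).sum + M * (Real.exp (δ * L) - 1) := by
  set w : ℕ → ℝ := fun n ↦ if n = 0 then 0 else 1 with hw
  have h := logSeries_template R S δ M w abs_ite_le_one L
  have hNG : NG R S δ M L = logSeries (fun n ↦ w n * powCoeff R S δ M n) L := by
    rw [NG]; congr 1; funext n; simp only [cNG, hw]; split_ifs <;> simp
  have key : ∀ z : ℂ, logSeries (fun n ↦ w n * (z ^ n).re) L = (Complex.exp (z * L) - 1).re := by
    intro z
    rw [re_exp_sub_one_eq_logSeries]
    congr 1; funext n; simp only [hw]; split_ifs <;> simp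
  have eδ : logSeries (fun n ↦ w n * δ ^ n) L = Real.exp (δ * L) - 1 := by
    have h1 := key δ
    have h2 : (fun n ↦ w n * (((δ : ℂ)) ^ n).re) = fun n ↦ w n * δ ^ n := by
      funext n; rw [← Complex.ofReal_pow, Complex.ofReal_re]
    rw [h2] at h1
    rw [h1, ← Complex.ofReal_mul, ← Complex.ofReal_exp, ← Complex.ofReal_one, ← Complex.ofReal_sub, Complex.ofReal_re]
  rw [hNG, h]
  simp only [key, eδ]

/-- `e^{z log x} = x^z` for `x > 0`. [folklore] -/
theorem exp_mul_log {x : ℝ} (hx : 0 < x) (z : ℂ) : Complex.exp (z * Real.log x) = (x : ℂ) ^ z := by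
  rw [Complex.cpow_def_of_ne_zero (Complex.ofReal_ne_zero.2 hx.ne'), ← Complex.ofReal_log hx.le, mul_comm]

/-- **`NG(log x) = (x − 1) + Σ_𝒮 Re(x^ω − 1) − Σ_ℛ Re(x^ρ − 1) + M(x^δ − 1)`** for `x > 0` (so that
`G′(x) = Re Σ_z c_z (x^{z−1} − x^{−1})/log x`). [cite: BrouckeDebruyneRevesz2023, §2 (2.5) and proof of Theorem 3.2] -/
theorem NG_log_eq {x : ℝ} (hx : 0 < x) :
    NG R S δ M (Real.log x) = (x - 1) + (S.map fun ω ↦ ((x : ℂ) ^ ω - 1).re).sum -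
      (R.map fun ρ ↦ ((x : ℂ) ^ ρ - 1).re).sum + M * (x ^ δ - 1) := by
  rw [NG_eq]
  simp only [exp_mul_log hx]
  have h1 : ((x : ℂ) ^ (1 : ℂ) - 1).re = x - 1 := by
    rw [Complex.cpow_one, Complex.sub_re, Complex.ofReal_re, Complex.one_re]
  have h2 : Real.exp (δ * Real.log x) = x ^ δ := by rw [Real.rpow_def_of_pos hx, mul_comm]
  rw [h1, h2]

/-- `NF = NF₀ + M Re ℓ_δ` where `NF₀` is the template without the `δ`-term (`M = 0`). [cite: BrouckeDebruyneRevesz2023, proof of Lemma 3.1] -/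
theorem NF_eq_NF0_add (L : ℝ) : NF R S δ M L = NF R S δ 0 L + M * (liKernel δ L).re := by
  rw [NF_eq, NF_eq]; push_cast; ring

end Decomp

/-! ### Lemma 3.1: `F` is strictly increasing for `M ≥ M₀` -/

section Lemma31

variable (R S)

/-- The splitting parameter `K = ⌈2Q⌉ + 1` (so `K ≥ 1` and `K ≥ 2|z|` for every exponent). [folklore] -/
def splitK : ℕ := ⌈2 * normBound R S⌉₊ + 1

/-- `1 ≤ K`. [folklore] -/
theorem one_le_splitK : 1 ≤ splitK R S := Nat.le_add_left 1 _

/-- `2‖z‖ ≤ K` whenever `‖z‖ ≤ Q`. [folklore] -/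
theorem two_mul_norm_le_splitK {z : ℂ} (hz : ‖z‖ ≤ normBound R S) : 2 * ‖z‖ ≤ (splitK R S : ℝ) := by
  unfold splitK
  push_cast
  have := Nat.le_ceil (2 * normBound R S)
  linarith

/-- The constant `H = H_K`. [folklore] -/
def Hc : ℝ := ((harmonic (splitK R S) : ℚ) : ℝ)

/-- `1 ≤ H`. [folklore] -/
theorem one_le_Hc : 1 ≤ Hc R S := one_le_harmonic_cast (one_le_splitK R S)

variable {R S}

/-- Lower bound for one `li(x^ω)`-term: `Re ℓ_ω(log x) ≥ −(x^{Re ω} + 1) − H(√x + 1)` (`Re ω ≤ 1`, `‖ω‖ ≤ Q`, `x ≥ 1`).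
[cite: BrouckeDebruyneRevesz2023, proof of Lemma 3.1] -/
theorem re_liKernel_ge {z : ℂ} (hz1 : z.re ≤ 1) (hzQ : ‖z‖ ≤ normBound R S) {x : ℝ} (hx : 1 ≤ x) :
    -(x ^ z.re + 1) - Hc R S * (Real.sqrt x + 1) ≤ (liKernel z (Real.log x)).re := by
  have hx0 : 0 < x := by linarith
  have h := abs_re_liKernel_sub_le hz1 hx (one_le_splitK R S) (two_mul_norm_le_splitK R S hzQ)
  have h2 : |((x : ℂ) ^ z - 1).re| ≤ x ^ z.re + 1 := by
    calc |((x : ℂ) ^ z - 1).re| ≤ ‖(x : ℂ) ^ z - 1‖ := abs_re_le_norm _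
      _ ≤ ‖(x : ℂ) ^ z‖ + ‖(1 : ℂ)‖ := norm_sub_le _ _
      _ = x ^ z.re + 1 := by rw [Complex.norm_cpow_eq_rpow_re_of_pos hx0, norm_one]
  rw [Hc]
  have := abs_le.1 h; have := abs_le.1 h2
  linarith

/-- Upper bound for one `li(x^ω)`-term: `Re ℓ_ω(log x) ≤ (x^{Re ω} + 1) + H(√x + 1)`. [cite: BrouckeDebruyneRevesz2023, proof of Lemma 3.1] -/
theorem re_liKernel_le {z : ℂ} (hz1 : z.re ≤ 1) (hzQ : ‖z‖ ≤ normBound R S) {x : ℝ} (hx : 1 ≤ x) :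
    (liKernel z (Real.log x)).re ≤ (x ^ z.re + 1) + Hc R S * (Real.sqrt x + 1) := by
  have hx0 : 0 < x := by linarith
  have h := abs_re_liKernel_sub_le hz1 hx (one_le_splitK R S) (two_mul_norm_le_splitK R S hzQ)
  have h2 : |((x : ℂ) ^ z - 1).re| ≤ x ^ z.re + 1 := by
    calc |((x : ℂ) ^ z - 1).re| ≤ ‖(x : ℂ) ^ z - 1‖ := abs_re_le_norm _
      _ ≤ ‖(x : ℂ) ^ z‖ + ‖(1 : ℂ)‖ := norm_sub_le _ _
      _ = x ^ z.re + 1 := by rw [Complex.norm_cpow_eq_rpow_re_of_pos hx0, norm_one]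
  rw [Hc]
  have := abs_le.1 h; have := abs_le.1 h2
  linarith

/-- The main term: `Re ℓ₁(log x) ≥ (x − 1) − H(√x + 1)`. [cite: BrouckeDebruyneRevesz2023, proof of Lemma 3.1] -/
theorem re_liKernel_one_ge {x : ℝ} (hx : 1 ≤ x) : (x - 1) - Hc R S * (Real.sqrt x + 1) ≤ (liKernel 1 (Real.log x)).re := by
  have h1Q : ‖(1 : ℂ)‖ ≤ normBound R S := by rw [norm_one]; exact one_le_normBound
  have h := abs_re_liKernel_sub_le (z := 1) (by simp) hx (one_le_splitK R S) (two_mul_norm_le_splitK R S h1Q)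
  have h2 : ((x : ℂ) ^ (1 : ℂ) - 1).re = x - 1 := by
    rw [Complex.cpow_one, Complex.sub_re, Complex.ofReal_re, Complex.one_re]
  rw [h2] at h
  rw [Hc]
  have := abs_le.1 h
  linarith

/-- And `Re ℓ₁(log x) ≤ (x − 1) + H(√x + 1)`. [cite: BrouckeDebruyneRevesz2023, proof of Lemma 3.1] -/
theorem re_liKernel_one_le {x : ℝ} (hx : 1 ≤ x) : (liKernel 1 (Real.log x)).re ≤ (x - 1) + Hc R S * (Real.sqrt x + 1) := by
  have h1Q : ‖(1 : ℂ)‖ ≤ normBound R S := by rw [norm_one]; exact one_le_normBound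
  have h := abs_re_liKernel_sub_le (z := 1) (by simp) hx (one_le_splitK R S) (two_mul_norm_le_splitK R S h1Q)
  have h2 : ((x : ℂ) ^ (1 : ℂ) - 1).re = x - 1 := by
    rw [Complex.cpow_one, Complex.sub_re, Complex.ofReal_re, Complex.one_re]
  rw [h2] at h
  rw [Hc]
  have := abs_le.1 h
  linarith

variable (R S)

/-- The error function `E(x) = 1 + H(√x+1) + Σ_𝒮 (x^{Re ω} + 1 + H(√x+1)) + Σ_ℛ (x^{Re ρ} + 1 + H(√x+1))`, with
`NF₀(log x) ≥ x − E(x)`. [cite: BrouckeDebruyneRevesz2023, proof of Lemma 3.1] -/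
def errE (x : ℝ) : ℝ :=
  1 + Hc R S * (Real.sqrt x + 1) + (S.map fun ω ↦ x ^ ω.re + 1 + Hc R S * (Real.sqrt x + 1)).sum +
    (R.map fun ρ ↦ x ^ ρ.re + 1 + Hc R S * (Real.sqrt x + 1)).sum

variable {R S}

/-- **`NF₀(log x) ≥ x − E(x)`** for `x ≥ 1` (`Re ω, Re ρ ≤ 1`). [cite: BrouckeDebruyneRevesz2023, proof of Lemma 3.1] -/
theorem sub_errE_le_NF0 (hS : ∀ ω ∈ S, ω.re ≤ 1) (hR : ∀ ρ ∈ R, ρ.re ≤ 1) {x : ℝ} (hx : 1 ≤ x) :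
    x - errE R S x ≤ NF R S δ 0 (Real.log x) := by
  rw [NF_eq, errE]
  simp only [Nat.cast_zero, zero_mul, add_zero]
  have h1 := re_liKernel_one_ge (R := R) (S := S) hx
  have hSle : (S.map fun ω ↦ -(x ^ ω.re + 1) - Hc R S * (Real.sqrt x + 1)).sum ≤ (S.map fun ω ↦ (liKernel ω (Real.log x)).re).sum :=
    Multiset.sum_map_le_sum_map _ _ fun ω hω ↦ re_liKernel_ge (hS ω hω) (norm_le_normBound_of_mem_S (R := R) hω) hx
  have hRle : (R.map fun ρ ↦ (liKernel ρ (Real.log x)).re).sum ≤ (R.map fun ρ ↦ (x ^ ρ.re + 1) + Hc R S * (Real.sqrt x + 1)).sum :=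
    Multiset.sum_map_le_sum_map _ _ fun ρ hρ ↦ re_liKernel_le (hR ρ hρ) (norm_le_normBound_of_mem_R (S := S) hρ) hx
  have hSneg : (S.map fun ω ↦ -(x ^ ω.re + 1) - Hc R S * (Real.sqrt x + 1)).sum =
      -(S.map fun ω ↦ x ^ ω.re + 1 + Hc R S * (Real.sqrt x + 1)).sum := by
    rw [← Multiset.sum_map_neg]; congr 1; refine Multiset.map_congr rfl fun ω _ ↦ by ring
  rw [hSneg] at hSle
  linarith

/-- **`NF₀(log x) ≤ x − 1 + E'(x)`-type upper bound**: `NF₀(log x) ≤ (x − 1) + H(√x+1) + Σ_𝒮 (…) + Σ_ℛ (…)`, in the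
crude form `NF₀(log x) ≤ errE x + x`. [cite: BrouckeDebruyneRevesz2023, proof of Lemma 3.1] -/
theorem NF0_le_add_errE (hS : ∀ ω ∈ S, ω.re ≤ 1) (hR : ∀ ρ ∈ R, ρ.re ≤ 1) {x : ℝ} (hx : 1 ≤ x) :
    NF R S δ 0 (Real.log x) ≤ x + errE R S x := by
  rw [NF_eq, errE]
  simp only [Nat.cast_zero, zero_mul, add_zero]
  have h1 := re_liKernel_one_le (R := R) (S := S) hx
  have hSle : (S.map fun ω ↦ (liKernel ω (Real.log x)).re).sum ≤ (S.map fun ω ↦ (x ^ ω.re + 1) + Hc R S * (Real.sqrt x + 1)).sum :=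
    Multiset.sum_map_le_sum_map _ _ fun ω hω ↦ re_liKernel_le (hS ω hω) (norm_le_normBound_of_mem_S (R := R) hω) hx
  have hRle : (R.map fun ρ ↦ -(x ^ ρ.re + 1) - Hc R S * (Real.sqrt x + 1)).sum ≤ (R.map fun ρ ↦ (liKernel ρ (Real.log x)).re).sum :=
    Multiset.sum_map_le_sum_map _ _ fun ρ hρ ↦ re_liKernel_ge (hR ρ hρ) (norm_le_normBound_of_mem_R (S := S) hρ) hx
  have hRneg : (R.map fun ρ ↦ -(x ^ ρ.re + 1) - Hc R S * (Real.sqrt x + 1)).sum =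
      -(R.map fun ρ ↦ x ^ ρ.re + 1 + Hc R S * (Real.sqrt x + 1)).sum := by
    rw [← Multiset.sum_map_neg]; congr 1; refine Multiset.map_congr rfl fun ρ _ ↦ by ring
  rw [hRneg] at hRle
  have h0 : 0 ≤ (1 : ℝ) := zero_le_one
  linarith

/-- One error piece divided by `x` tends to `0`: `(x^a + b + H(√x + 1))/x → 0` for `a < 1`. [folklore] -/
theorem tendsto_err_piece {a H : ℝ} (b : ℝ) (ha : a < 1) :
    Tendsto (fun x : ℝ ↦ (x ^ a + b + H * (Real.sqrt x + 1)) / x) atTop (𝓝 0) := by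
  have h1 : Tendsto (fun x : ℝ ↦ x ^ (-(1 - a))) atTop (𝓝 0) := tendsto_rpow_neg_atTop (by linarith)
  have h2 : Tendsto (fun x : ℝ ↦ x ^ (-(1 / 2 : ℝ))) atTop (𝓝 0) := tendsto_rpow_neg_atTop (by norm_num)
  have h3 : Tendsto (fun x : ℝ ↦ x⁻¹) atTop (𝓝 0) := tendsto_inv_atTop_zero
  have h : Tendsto (fun x : ℝ ↦ x ^ (-(1 - a)) + b * x⁻¹ + H * (x ^ (-(1 / 2 : ℝ)) + x⁻¹)) atTop
      (𝓝 (0 + b * 0 + H * (0 + 0))) :=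
    (h1.add (h3.const_mul b)).add ((h2.add h3).const_mul H)
  simp only [add_zero, mul_zero] at h
  refine h.congr' ?_
  filter_upwards [eventually_gt_atTop (0 : ℝ)] with x hx
  rw [Real.sqrt_eq_rpow, show (-(1 - a)) = a - 1 by ring, Real.rpow_sub_one hx.ne',
    show (-(1 / 2 : ℝ)) = 1 / 2 - 1 by norm_num, Real.rpow_sub_one hx.ne']
  ring

/-- **`E(x)/x → 0`** (`Re ω, Re ρ < 1`). [cite: BrouckeDebruyneRevesz2023, proof of Lemma 3.1 ("The right-hand side is eventually positive")] -/
theorem tendsto_errE_div (hS : ∀ ω ∈ S, ω.re < 1) (hR : ∀ ρ ∈ R, ρ.re < 1) :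
    Tendsto (fun x : ℝ ↦ errE R S x / x) atTop (𝓝 0) := by
  have h0 : Tendsto (fun x : ℝ ↦ (x ^ (0 : ℝ) + 0 + Hc R S * (Real.sqrt x + 1)) / x) atTop (𝓝 0) :=
    tendsto_err_piece 0 zero_lt_one
  have hSt : Tendsto (fun x : ℝ ↦ (S.map fun ω ↦ (x ^ ω.re + 1 + Hc R S * (Real.sqrt x + 1)) / x).sum) atTop
      (𝓝 (S.map fun _ ↦ (0 : ℝ)).sum) :=
    tendsto_multiset_sum S fun ω hω ↦ tendsto_err_piece 1 (hS ω hω)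
  have hRt : Tendsto (fun x : ℝ ↦ (R.map fun ρ ↦ (x ^ ρ.re + 1 + Hc R S * (Real.sqrt x + 1)) / x).sum) atTop
      (𝓝 (R.map fun _ ↦ (0 : ℝ)).sum) :=
    tendsto_multiset_sum R fun ρ hρ ↦ tendsto_err_piece 1 (hR ρ hρ)
  simp only [Multiset.map_const', Multiset.sum_replicate, smul_zero] at hSt hRt
  have h := (h0.add hSt).add hRt
  simp only [add_zero] at h
  refine h.congr' ?_
  filter_upwards [eventually_gt_atTop (0 : ℝ)] with x hx
  have e : ∀ (X : Multiset ℂ) (f : ℂ → ℝ), (X.map fun z ↦ f z / x).sum = (X.map f).sum / x := fun X f ↦ by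
    simp only [div_eq_mul_inv, Multiset.sum_map_mul_right]
  rw [e, e, errE, Real.rpow_zero]
  ring

/-- **Large `x`: `NF₀(log x) ≥ x/2` for `x ≥ X₀`.** [cite: BrouckeDebruyneRevesz2023, proof of Lemma 3.1] -/
theorem exists_X0_half_le_NF0 (hS : ∀ ω ∈ S, ω.re < 1) (hR : ∀ ρ ∈ R, ρ.re < 1) :
    ∃ X0 : ℝ, 1 ≤ X0 ∧ ∀ x : ℝ, X0 ≤ x → x / 2 ≤ NF R S δ 0 (Real.log x) := by
  have h := tendsto_errE_div (R := R) (S := S) hS hR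
  have hev : ∀ᶠ x in atTop, errE R S x / x ≤ 1 / 2 := by
    have := h.eventually (Iic_mem_nhds (show (0 : ℝ) < 1 / 2 by norm_num))
    exact this
  obtain ⟨X, hX⟩ := Filter.eventually_atTop.1 (hev.and (eventually_ge_atTop (1 : ℝ)))
  refine ⟨max X 1, le_max_right _ _, fun x hx ↦ ?_⟩
  have hxX : X ≤ x := le_trans (le_max_left _ _) hx
  obtain ⟨h1, h2⟩ := hX x hxX
  have hx0 : 0 < x := by linarith
  have h3 : errE R S x ≤ x / 2 := by
    rw [div_le_iff₀ hx0] at h1; linarith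
  have h4 := sub_errE_le_NF0 (δ := δ) (fun ω hω ↦ (hS ω hω).le) (fun ρ hρ ↦ (hR ρ hρ).le) h2
  linarith

/-- `cNF` with `M = 0` has vanishing constant term and the bound `B₀ Qⁿ`. [folklore] -/
theorem abs_NF0_le (hδ : 0 ≤ δ) (hδ1 : δ ≤ 1) (L : ℝ) :
    |NF R S δ 0 L| ≤ sizeBound R S 0 * (Real.exp (normBound R S * |L|) - 1) :=
  abs_logSeries_le_exp_sub_one sizeBound_nonneg normBound_nonneg (by simp [cNF, invZetaCoeff])
    (abs_cNF_le hδ hδ1) L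

/-- **Lemma 3.1 (Broucke–Debruyne–Révész 2023).** "Let `0 < δ < 1` and let `𝒮`, `ℛ` be two finite, symmetric
multisets satisfying `Re ω, Re ρ ∈ (0,1)` … Then there exists a positive number `M₀ = M₀(δ; 𝒮, ℛ)`, such that for any
`M ≥ M₀` the function `F(x) = li(x) + Σ_𝒮 li(x^ω) − Σ_ℛ li(x^ρ) + M li(x^δ)` is strictly increasing." Here in the form
`x log x F′(x) = NF(log x) > 0` for all `x > 1` (only `Re ω, Re ρ < 1` and `0 < δ ≤ 1` are used; symmetry is built into
the real-part template). [cite: BrouckeDebruyneRevesz2023, Lemma 3.1] -/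
theorem exists_M0_NF_pos (hS : ∀ ω ∈ S, ω.re < 1) (hR : ∀ ρ ∈ R, ρ.re < 1) (hδ : 0 < δ) (hδ1 : δ ≤ 1) :
    ∃ M0 : ℕ, ∀ M : ℕ, M0 ≤ M → ∀ x : ℝ, 1 < x → 0 < NF R S δ M (Real.log x) := by
  obtain ⟨X0, hX0, hlarge⟩ := exists_X0_half_le_NF0 (R := R) (S := S) (δ := δ) hS hR
  set L0 : ℝ := Real.log X0 with hL0
  set B0 : ℝ := sizeBound R S 0 with hB0
  set Q : ℝ := normBound R S with hQ
  set C : ℝ := B0 * Q * Real.exp (Q * L0) with hC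
  have hB0pos : 0 < B0 := lt_of_lt_of_le one_pos one_le_sizeBound
  have hQpos : 0 < Q := lt_of_lt_of_le one_pos one_le_normBound
  have hCpos : 0 < C := by positivity
  refine ⟨⌈2 * C / δ⌉₊ + 1, fun M hM x hx ↦ ?_⟩
  have hMr : 2 * C / δ < M := by
    have h1 := Nat.le_ceil (2 * C / δ)
    have h2 : (⌈2 * C / δ⌉₊ : ℝ) + 1 ≤ M := by exact_mod_cast hM
    linarith
  have hMδ : 2 * C < M * δ := by rwa [div_lt_iff₀ hδ] at hMr
  set L : ℝ := Real.log x with hL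
  have hLpos : 0 < L := Real.log_pos hx
  rw [NF_eq_NF0_add]
  have hℓ := half_mul_le_re_liKernel hδ.le hLpos.le
  rcases le_or_gt X0 x with hxX | hxX
  · -- large `x`
    have h1 := hlarge x hxX
    have hM0 : (0 : ℝ) ≤ M * (liKernel δ L).re := mul_nonneg (Nat.cast_nonneg _) (re_liKernel_nonneg hδ.le hLpos.le)
    have : (0 : ℝ) < x / 2 := by linarith
    rw [← hL] at h1
    linarith
  · -- small `x`: `0 < L < L0`
    have hLL0 : L ≤ L0 := Real.log_le_log (by linarith) hxX.le
    have h1 : |NF R S δ 0 L| ≤ B0 * (Real.exp (Q * |L|) - 1) := abs_NF0_le hδ.le hδ1 L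
    rw [abs_of_pos hLpos] at h1
    have h2 : Real.exp (Q * L) - 1 ≤ Q * L * Real.exp (Q * L) := (by
      have h := Real.add_one_le_exp (-(Q * L))
      have he := Real.exp_pos (Q * L)
      have : Real.exp (-(Q * L)) * Real.exp (Q * L) = 1 := by rw [← Real.exp_add]; simp
      nlinarith)
    have h3 : Real.exp (Q * L) ≤ Real.exp (Q * L0) := Real.exp_le_exp.2 (mul_le_mul_of_nonneg_left hLL0 hQpos.le)
    have h4 : |NF R S δ 0 L| ≤ C * L := by
      calc |NF R S δ 0 L| ≤ B0 * (Q * L * Real.exp (Q * L)) := h1.trans (mul_le_mul_of_nonneg_left h2 hB0pos.le)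
        _ ≤ B0 * (Q * L * Real.exp (Q * L0)) := by gcongr
        _ = C * L := by rw [hC]; ring
    have h5 := (abs_le.1 h4).1
    have h6 : C * L < M * (δ * L / 2) := by nlinarith
    nlinarith [mul_le_mul_of_nonneg_left hℓ (Nat.cast_nonneg M)]

/-- `NF ≥ NF₀` for `L ≥ 0` (`δ ≥ 0`). [folklore] -/
theorem NF0_le_NF (hδ : 0 ≤ δ) {L : ℝ} (hL : 0 ≤ L) : NF R S δ 0 L ≤ NF R S δ M L := by
  rw [NF_eq_NF0_add (M := M)]
  have := mul_nonneg (Nat.cast_nonneg M) (re_liKernel_nonneg hδ hL)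
  linarith

end Lemma31

/-! ### Chebyshev-type upper bounds -/

section Upper

/-- `E(x) ≤ C_E x` for `x ≥ 1`, with `C_E = (1 + 2H)(1 + |𝒮| + |ℛ|) + (|𝒮| + |ℛ|)`… in the crude form
`E(x) ≤ (3 + 2H)(1 + |𝒮| + |ℛ|) x`. [folklore] -/
theorem errE_le (hS : ∀ ω ∈ S, ω.re ≤ 1) (hR : ∀ ρ ∈ R, ρ.re ≤ 1) {x : ℝ} (hx : 1 ≤ x) :
    errE R S x ≤ (3 + 2 * Hc R S) * (1 + Multiset.card S + Multiset.card R) * x := by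
  have hx0 : 0 ≤ x := by linarith
  have hH : 1 ≤ Hc R S := one_le_Hc R S
  have hsqrt : Real.sqrt x ≤ x := by
    rw [Real.sqrt_le_left hx0]; nlinarith
  have hpiece : ∀ a : ℝ, a ≤ 1 → x ^ a + 1 + Hc R S * (Real.sqrt x + 1) ≤ (3 + 2 * Hc R S) * x := by
    intro a ha
    have h1 : x ^ a ≤ x := by
      calc x ^ a ≤ x ^ (1 : ℝ) := Real.rpow_le_rpow_of_exponent_le hx ha
        _ = x := Real.rpow_one x
    nlinarith
  have hSle : (S.map fun ω ↦ x ^ ω.re + 1 + Hc R S * (Real.sqrt x + 1)).sum ≤ (S.map fun _ ↦ (3 + 2 * Hc R S) * x).sum :=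
    Multiset.sum_map_le_sum_map _ _ fun ω hω ↦ hpiece ω.re (hS ω hω)
  have hRle : (R.map fun ρ ↦ x ^ ρ.re + 1 + Hc R S * (Real.sqrt x + 1)).sum ≤ (R.map fun _ ↦ (3 + 2 * Hc R S) * x).sum :=
    Multiset.sum_map_le_sum_map _ _ fun ρ hρ ↦ hpiece ρ.re (hR ρ hρ)
  simp only [Multiset.map_const', Multiset.sum_replicate, nsmul_eq_mul] at hSle hRle
  rw [errE]
  nlinarith

/-- **`NF(log x) ≤ C_F x` for `x ≥ 1`** with `C_F = 1 + (3 + 2H)(1 + |𝒮| + |ℛ|) + M` (`0 ≤ δ ≤ 1`, `Re ω, Re ρ ≤ 1`).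
[cite: BrouckeDebruyneRevesz2023, proof of Theorem 3.2 ("admits a bound F(x) ≪ x/log x")] -/
theorem NF_log_le (hS : ∀ ω ∈ S, ω.re ≤ 1) (hR : ∀ ρ ∈ R, ρ.re ≤ 1) (hδ : 0 ≤ δ) (hδ1 : δ ≤ 1) {x : ℝ} (hx : 1 ≤ x) :
    NF R S δ M (Real.log x) ≤ (1 + (3 + 2 * Hc R S) * (1 + Multiset.card S + Multiset.card R) + M) * x := by
  have hx0 : 0 < x := by linarith
  rw [NF_eq_NF0_add]
  have h1 := NF0_le_add_errE (δ := δ) hS hR hx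
  have h2 := errE_le hS hR hx
  have h3 : (liKernel δ (Real.log x)).re ≤ x := by
    have h := re_liKernel_le_exp_sub_one hδ (Real.log_nonneg hx)
    have h4 : Real.exp (δ * Real.log x) = x ^ δ := by rw [Real.rpow_def_of_pos hx0, mul_comm]
    rw [h4] at h
    have h5 : x ^ δ ≤ x := by
      calc x ^ δ ≤ x ^ (1 : ℝ) := Real.rpow_le_rpow_of_exponent_le hx hδ1
        _ = x := Real.rpow_one x
    linarith
  have h4 : (M : ℝ) * (liKernel δ (Real.log x)).re ≤ M * x := mul_le_mul_of_nonneg_left h3 (Nat.cast_nonneg _)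
  nlinarith

/-- **`|NG(log x)| ≤ (1 + 2|𝒮| + 2|ℛ| + M) x` for `x ≥ 1`** (`0 ≤ δ ≤ 1`, `Re ω, Re ρ ≤ 1`). [cite: BrouckeDebruyneRevesz2023, proof of Theorem 3.2] -/
theorem abs_NG_log_le (hS : ∀ ω ∈ S, ω.re ≤ 1) (hR : ∀ ρ ∈ R, ρ.re ≤ 1) (hδ : 0 ≤ δ) (hδ1 : δ ≤ 1) {x : ℝ} (hx : 1 ≤ x) :
    |NG R S δ M (Real.log x)| ≤ (1 + 2 * Multiset.card S + 2 * Multiset.card R + M) * x := by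
  have hx0 : 0 < x := by linarith
  rw [NG_log_eq R S δ M hx0]
  have hpiece : ∀ z : ℂ, z.re ≤ 1 → |((x : ℂ) ^ z - 1).re| ≤ 2 * x := by
    intro z hz
    calc |((x : ℂ) ^ z - 1).re| ≤ ‖(x : ℂ) ^ z - 1‖ := abs_re_le_norm _
      _ ≤ ‖(x : ℂ) ^ z‖ + ‖(1 : ℂ)‖ := norm_sub_le _ _
      _ = x ^ z.re + 1 := by rw [Complex.norm_cpow_eq_rpow_re_of_pos hx0, norm_one]
      _ ≤ x + x := by
          have : x ^ z.re ≤ x := by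
            calc x ^ z.re ≤ x ^ (1 : ℝ) := Real.rpow_le_rpow_of_exponent_le hx hz
              _ = x := Real.rpow_one x
          linarith
      _ = 2 * x := by ring
  have hSle : |(S.map fun ω ↦ ((x : ℂ) ^ ω - 1).re).sum| ≤ 2 * Multiset.card S * x := by
    refine Multiset.abs_sum_le_sum_abs.trans ?_
    rw [Multiset.map_map]
    have h := Multiset.sum_map_le_sum_map (s := S) (fun ω ↦ |((x : ℂ) ^ ω - 1).re|) (fun _ ↦ 2 * x)
      fun ω hω ↦ hpiece ω (hS ω hω)
    simp only [Multiset.map_const', Multiset.sum_replicate, nsmul_eq_mul] at h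
    calc _ ≤ (Multiset.card S : ℝ) * (2 * x) := h
      _ = _ := by ring
  have hRle : |(R.map fun ρ ↦ ((x : ℂ) ^ ρ - 1).re).sum| ≤ 2 * Multiset.card R * x := by
    refine Multiset.abs_sum_le_sum_abs.trans ?_
    rw [Multiset.map_map]
    have h := Multiset.sum_map_le_sum_map (s := R) (fun ρ ↦ |((x : ℂ) ^ ρ - 1).re|) (fun _ ↦ 2 * x)
      fun ρ hρ ↦ hpiece ρ (hR ρ hρ)
    simp only [Multiset.map_const', Multiset.sum_replicate, nsmul_eq_mul] at h
    calc _ ≤ (Multiset.card R : ℝ) * (2 * x) := h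
      _ = _ := by ring
  have hδle : |(M : ℝ) * (x ^ δ - 1)| ≤ M * x := by
    rw [abs_mul, Nat.abs_cast]
    refine mul_le_mul_of_nonneg_left ?_ (Nat.cast_nonneg _)
    have h1 : x ^ δ ≤ x := by
      calc x ^ δ ≤ x ^ (1 : ℝ) := Real.rpow_le_rpow_of_exponent_le hx hδ1
        _ = x := Real.rpow_one x
    have h2 : 1 ≤ x ^ δ := Real.one_le_rpow hx hδ
    rw [abs_le]; constructor <;> linarith
  have h1 : |x - 1| ≤ x := by rw [abs_le]; constructor <;> linarith
  calc |x - 1 + (S.map fun ω ↦ ((x : ℂ) ^ ω - 1).re).sum - (R.map fun ρ ↦ ((x : ℂ) ^ ρ - 1).re).sum + M * (x ^ δ - 1)|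
      ≤ |x - 1| + |(S.map fun ω ↦ ((x : ℂ) ^ ω - 1).re).sum| + |(R.map fun ρ ↦ ((x : ℂ) ^ ρ - 1).re).sum| +
          |(M : ℝ) * (x ^ δ - 1)| := by
        have := abs_add_le (x - 1 + (S.map fun ω ↦ ((x : ℂ) ^ ω - 1).re).sum - (R.map fun ρ ↦ ((x : ℂ) ^ ρ - 1).re).sum)
          ((M : ℝ) * (x ^ δ - 1))
        have := abs_sub (x - 1 + (S.map fun ω ↦ ((x : ℂ) ^ ω - 1).re).sum) (R.map fun ρ ↦ ((x : ℂ) ^ ρ - 1).re).sum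
        have := abs_add_le (x - 1) (S.map fun ω ↦ ((x : ℂ) ^ ω - 1).re).sum
        linarith
    _ ≤ x + 2 * Multiset.card S * x + 2 * Multiset.card R * x + M * x := by linarith
    _ = (1 + 2 * Multiset.card S + 2 * Multiset.card R + M) * x := by ring

/-- `|NF(L)| ≤ B(e^{Q|L|} − 1)`. [folklore] -/
theorem abs_NF_le (hδ : 0 ≤ δ) (hδ1 : δ ≤ 1) (L : ℝ) :
    |NF R S δ M L| ≤ sizeBound R S M * (Real.exp (normBound R S * |L|) - 1) :=
  abs_logSeries_le_exp_sub_one sizeBound_nonneg normBound_nonneg (by simp [cNF, invZetaCoeff]) (abs_cNF_le hδ hδ1) L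

/-- `|NG(L)| ≤ B(e^{Q|L|} − 1)`. [folklore] -/
theorem abs_NG_le (hδ : 0 ≤ δ) (hδ1 : δ ≤ 1) (L : ℝ) :
    |NG R S δ M L| ≤ sizeBound R S M * (Real.exp (normBound R S * |L|) - 1) :=
  abs_logSeries_le_exp_sub_one sizeBound_nonneg normBound_nonneg (by simp [cNG]) (abs_cNG_le hδ hδ1) L

/-- Near `u = 1`: a series value `|N(L)| ≤ B(e^{QL} − 1)` gives a bounded density `|N(log u)|/(u log u) ≤ BQe^{Q}` on
`(1, e]`. [folklore] -/
theorem density_bound_near_one {N : ℝ → ℝ} {B Q : ℝ} (hB : 0 ≤ B) (hQ : 0 ≤ Q)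
    (hN : ∀ L, |N L| ≤ B * (Real.exp (Q * |L|) - 1)) {u : ℝ} (hu : 1 < u) (hue : u ≤ Real.exp 1) :
    |N (Real.log u) / (u * Real.log u)| ≤ B * Q * Real.exp Q := by
  have hu0 : 0 < u := by linarith
  have hL : 0 < Real.log u := Real.log_pos hu
  have hL1 : Real.log u ≤ 1 := by
    have := Real.log_le_log hu0 hue; rwa [Real.log_exp] at this
  have h1 := hN (Real.log u)
  rw [abs_of_pos hL] at h1
  have h2 : Real.exp (Q * Real.log u) - 1 ≤ Q * Real.log u * Real.exp (Q * Real.log u) := by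
    have h := Real.add_one_le_exp (-(Q * Real.log u))
    have he := Real.exp_pos (Q * Real.log u)
    have : Real.exp (-(Q * Real.log u)) * Real.exp (Q * Real.log u) = 1 := by rw [← Real.exp_add]; simp
    nlinarith
  have h3 : Real.exp (Q * Real.log u) ≤ Real.exp Q := Real.exp_le_exp.2 (by nlinarith)
  rw [abs_div, abs_mul, abs_of_pos hu0, abs_of_pos hL, div_le_iff₀ (by positivity)]
  calc |N (Real.log u)| ≤ B * (Q * Real.log u * Real.exp (Q * Real.log u)) := h1.trans (mul_le_mul_of_nonneg_left h2 hB)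
    _ ≤ B * (Q * Real.log u * Real.exp Q) := by gcongr
    _ = B * Q * Real.exp Q * (1 * Real.log u) := by ring
    _ ≤ B * Q * Real.exp Q * (u * Real.log u) := by gcongr

/-- **`|densF u| ≤ C` on `(1, ∞)`** with `C = BQe^Q + C_F` (`Re ω, Re ρ ≤ 1`, `0 ≤ δ ≤ 1`). [folklore] -/
theorem abs_densF_le (hS : ∀ ω ∈ S, ω.re ≤ 1) (hR : ∀ ρ ∈ R, ρ.re ≤ 1) (hδ : 0 ≤ δ) (hδ1 : δ ≤ 1)
    (hpos : ∀ x : ℝ, 1 < x → 0 ≤ NF R S δ M (Real.log x)) (u : ℝ) :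
    |densF R S δ M u| ≤ sizeBound R S M * normBound R S * Real.exp (normBound R S) +
      (1 + (3 + 2 * Hc R S) * (1 + Multiset.card S + Multiset.card R) + M) := by
  have hB := sizeBound_nonneg (R := R) (S := S) (M := M)
  have hQ := normBound_nonneg (R := R) (S := S)
  have hC1 : 0 ≤ sizeBound R S M * normBound R S * Real.exp (normBound R S) := by positivity
  have hH := one_le_Hc R S
  have hC2 : 0 ≤ 1 + (3 + 2 * Hc R S) * (1 + Multiset.card S + Multiset.card R) + (M : ℝ) := by positivity
  by_cases hu : 1 < u
  · have hu0 : 0 < u := by linarith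
    rcases le_or_gt u (Real.exp 1) with hue | hue
    · have := density_bound_near_one hB hQ (abs_NF_le (R := R) (S := S) (M := M) hδ hδ1) hu hue
      rw [densF_of_one_lt hu]
      linarith
    · -- `u > e`: `log u > 1`
      have hL1 : 1 < Real.log u := by
        have := Real.log_lt_log (Real.exp_pos 1) hue; rwa [Real.log_exp] at this
      rw [densF_of_one_lt hu, abs_of_nonneg (div_nonneg (hpos u hu) (by positivity)), div_le_iff₀ (by positivity)]
      have h1 := NF_log_le (M := M) hS hR hδ hδ1 hu.le
      calc NF R S δ M (Real.log u) ≤ (1 + (3 + 2 * Hc R S) * (1 + Multiset.card S + Multiset.card R) + M) * u := h1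
        _ = (1 + (3 + 2 * Hc R S) * (1 + Multiset.card S + Multiset.card R) + M) * (u * 1) := by ring
        _ ≤ _ := by
            have : u * 1 ≤ u * Real.log u := mul_le_mul_of_nonneg_left hL1.le hu0.le
            nlinarith
  · rw [densF_of_le_one (not_lt.1 hu), abs_zero]; positivity

/-- **`densF u ≤ C_F/log u`** for `u > 1` (the bound giving `f(u) ≤ 2` eventually and `F(x) ≪ x/log x`). [cite: BrouckeDebruyneRevesz2023, proof of Theorem 3.2] -/
theorem densF_le_div_log (hS : ∀ ω ∈ S, ω.re ≤ 1) (hR : ∀ ρ ∈ R, ρ.re ≤ 1) (hδ : 0 ≤ δ) (hδ1 : δ ≤ 1) {u : ℝ}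
    (hu : 1 < u) :
    densF R S δ M u ≤ (1 + (3 + 2 * Hc R S) * (1 + Multiset.card S + Multiset.card R) + M) / Real.log u := by
  have hu0 : 0 < u := by linarith
  have hL : 0 < Real.log u := Real.log_pos hu
  rw [densF_of_one_lt hu, div_le_div_iff₀ (by positivity) hL]
  have h1 := NF_log_le (M := M) hS hR hδ hδ1 hu.le
  calc NF R S δ M (Real.log u) * Real.log u ≤ (1 + (3 + 2 * Hc R S) * (1 + Multiset.card S + Multiset.card R) + M) * u * Real.log u :=
        mul_le_mul_of_nonneg_right h1 hL.le
    _ = _ := by ring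

/-- **`|densG u| ≤ C` on `(1, ∞)`** with `C = BQe^Q + (1 + 2|𝒮| + 2|ℛ| + M)`. [folklore] -/
theorem abs_densG_le (hS : ∀ ω ∈ S, ω.re ≤ 1) (hR : ∀ ρ ∈ R, ρ.re ≤ 1) (hδ : 0 ≤ δ) (hδ1 : δ ≤ 1) (u : ℝ) :
    |densG R S δ M u| ≤ sizeBound R S M * normBound R S * Real.exp (normBound R S) +
      (1 + 2 * Multiset.card S + 2 * Multiset.card R + M) := by
  have hB := sizeBound_nonneg (R := R) (S := S) (M := M)
  have hQ := normBound_nonneg (R := R) (S := S)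
  have hC1 : 0 ≤ sizeBound R S M * normBound R S * Real.exp (normBound R S) := by positivity
  have hC2 : 0 ≤ 1 + 2 * (Multiset.card S : ℝ) + 2 * Multiset.card R + M := by positivity
  by_cases hu : 1 < u
  · have hu0 : 0 < u := by linarith
    rcases le_or_gt u (Real.exp 1) with hue | hue
    · have := density_bound_near_one hB hQ (abs_NG_le (R := R) (S := S) (M := M) hδ hδ1) hu hue
      rw [densG_of_one_lt hu]
      linarith
    · have hL1 : 1 < Real.log u := by
        have := Real.log_lt_log (Real.exp_pos 1) hue; rwa [Real.log_exp] at this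
      rw [densG_of_one_lt hu, abs_div, abs_mul, abs_of_pos hu0, abs_of_pos (by linarith : 0 < Real.log u),
        div_le_iff₀ (by positivity)]
      have h1 := abs_NG_log_le (M := M) hS hR hδ hδ1 hu.le
      calc |NG R S δ M (Real.log u)| ≤ (1 + 2 * Multiset.card S + 2 * Multiset.card R + M) * u := h1
        _ = (1 + 2 * Multiset.card S + 2 * Multiset.card R + M) * (u * 1) := by ring
        _ ≤ _ := by
            have : u * 1 ≤ u * Real.log u := mul_le_mul_of_nonneg_left hL1.le hu0.le
            nlinarith
  · rw [densG_of_le_one (not_lt.1 hu), abs_zero]; positivity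

end Upper

end BDRMultiset

end Literature.NumberTheory.BeurlingPrimes
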